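import Mathlib
import Summits.Ventures.PercRepro2.Harris
import Summits.Ventures.PercRepro2.BasePrime
import Summits.Ventures.PercRepro2.LocRows
import Summits.Ventures.PercRepro2.SwRow
import Summits.Ventures.PercRepro2.SwOut
import Summits.Ventures.PercRepro2.SwAllRow
import Summits.Ventures.PercRepro2.SwOutAll
import Summits.Ventures.PercRepro2.SwOutCube
import Summits.Ventures.PercRepro2.SwOutArmFlip
import Summits.Ventures.PercRepro2.SwOutArms
import Summits.Ventures.PercRepro2.SwOutArmOrbit
import Summits.Ventures.PercRepro2.SwOutArmCube
import Summits.Ventures.PercRepro2.SwOutArmThm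
import Summits.Ventures.PercRepro2.SwOutCoreDefs
import Summits.Ventures.PercRepro2.SwOutCoreDual
import Summits.Ventures.PercRepro2.SwOutShadowDefs
import Summits.Ventures.PercRepro2.SwOutShadowCube

/-!
# THE SHADOW CUBE INEQUALITY, continued (blind cell PercRepro2, night-4 g13, 2026-08-26;
proofs/NIGHT4-G12.md §3 (L4), proofs/NIGHT4-G13.md §3)

The edge sets of `h` along the shadow cube (`redEdges_shadowReal_mono`,
`blueEdges_shadowReal_anti`, `blueEdges_shadowReal_flipAll`), the outside class and the
conditioning `Q` (`shadowReal_mem_outClass`, `shadowReal_mem_tgtU_of_le`), and the rigid counting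
inequality on the shadow cube (**`card_shadowCube_le`**) by the cube principle
`card_le_of_cube_edges`.
-/

namespace Summit.Ventures.PercRepro2

namespace LocRows

open Hull

variable {V : Type*} {E : Type*}

open scoped Classical

variable {ends : E → Sym2 V}

section Edges

variable {κ : Type*} {B : κ → Set V} {Z : Set V} {k₀ : κ} {σ : Config E} {h : V}
  (hb : ShadowBase ends σ h Z B k₀)
include hb

/-- An edge inside `sRed ω` has an end in a red arm. -/
lemma ShadowBase.exists_red_arm_of_within_sRed {ω : Config κ} {e : E}
    (hw : e ∈ within ends (sRed B h ω)) : ∃ j x y, ends e = s(x, y) ∧ x ∈ B j ∧ ω j = true := by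
  obtain ⟨x, hx, y, hy, hxy⟩ := hw
  rw [mem_sRed_iff] at hx hy
  rcases hx with rfl | ⟨j, hj, hxj⟩
  · rcases hy with rfl | ⟨j, hj, hyj⟩
    · exact absurd hxy (hb.loop_h e)
    · exact ⟨j, y, x, ends_swap hxy, hyj, hj⟩
  · exact ⟨j, x, y, hxy, hxj, hj⟩

/-- The colour of an edge inside `sRed ω` does not change going up the cube. -/
lemma ShadowBase.shadowReal_apply_eq_of_within_sRed {ω ω' : Config κ} (hω : ω ≤ ω') {e : E}
    (hw : e ∈ within ends (sRed B h ω)) :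
    shadowReal ends B Z k₀ σ ω' e = shadowReal ends B Z k₀ σ ω e := by
  obtain ⟨j, x, y, hxy, hxj, hj⟩ := hb.exists_red_arm_of_within_sRed hw
  have hj' : ω' j = true := by
    have := hω j
    rw [hj] at this
    cases h' : ω' j
    · rw [h'] at this; exact absurd this (by simp)
    · rfl
  rw [hb.shadowReal_apply_of_mem hxy hxj, hb.shadowReal_apply_of_mem hxy hxj, if_pos hj, if_pos hj']

/-- **The red edge set of `h` grows with the cube point.** -/
theorem ShadowBase.redEdges_shadowReal_mono {ω ω' : Config κ} (hω : ω ≤ ω') :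
    redEdges ends (shadowReal ends B Z k₀ σ ω) h ⊆ redEdges ends (shadowReal ends B Z k₀ σ ω') h := by
  intro e he
  rw [mem_redEdges] at he ⊢
  obtain ⟨hred, hw⟩ := he
  rw [hb.cluster_shadowReal] at hw
  refine ⟨?_, ?_⟩
  · rw [hb.shadowReal_apply_eq_of_within_sRed hω hw]; exact hred
  · obtain ⟨x, hx, y, hy, hxy⟩ := hw
    rw [hb.cluster_shadowReal]
    exact ⟨x, hb.sRed_mono hω hx, y, hb.sRed_mono hω hy, hxy⟩

/-- **The blue edge set of `h` shrinks with the cube point.** -/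
theorem ShadowBase.blueEdges_shadowReal_anti {ω ω' : Config κ} (hω : ω ≤ ω') :
    blueEdges ends (shadowReal ends B Z k₀ σ ω') h ⊆ blueEdges ends (shadowReal ends B Z k₀ σ ω) h := by
  unfold blueEdges
  rw [hb.blue_shadowReal, hb.blue_shadowReal]
  exact hb.dual.redEdges_shadowReal_mono (flipAll_le_flipAll hω)

/-- The red edge sets of `h` of the base and of the dual base agree at every cube point. -/
lemma ShadowBase.redEdges_shadowReal_dual (ω : Config κ) :
    redEdges ends (shadowReal ends B Z k₀ (dualShadow ends B Z σ) ω) h =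
      redEdges ends (shadowReal ends B Z k₀ σ ω) h := by
  ext e
  rw [mem_redEdges, mem_redEdges, hb.cluster_shadowReal, hb.dual.cluster_shadowReal]
  constructor
  · rintro ⟨hred, hw⟩
    refine ⟨?_, hw⟩
    obtain ⟨j, x, y, hxy, hxj, hj⟩ := hb.exists_red_arm_of_within_sRed hw
    rw [hb.dual.shadowReal_apply_of_mem hxy hxj, if_pos hj,
      dualShadow_apply_of_mem ⟨x, Or.inl ⟨j, hxj⟩, y, hxy⟩] at hred
    rw [hb.shadowReal_apply_of_mem hxy hxj, if_pos hj]; exact hred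
  · rintro ⟨hred, hw⟩
    refine ⟨?_, hw⟩
    obtain ⟨j, x, y, hxy, hxj, hj⟩ := hb.exists_red_arm_of_within_sRed hw
    rw [hb.shadowReal_apply_of_mem hxy hxj, if_pos hj] at hred
    rw [hb.dual.shadowReal_apply_of_mem hxy hxj, if_pos hj,
      dualShadow_apply_of_mem ⟨x, Or.inl ⟨j, hxj⟩, y, hxy⟩]; exact hred

/-- **The flip of the cube exchanges the red and the blue edge sets.** -/
theorem ShadowBase.blueEdges_shadowReal_flipAll (ω : Config κ) :
    blueEdges ends (shadowReal ends B Z k₀ σ (flipAll ω)) h =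
      redEdges ends (shadowReal ends B Z k₀ σ ω) h := by
  unfold blueEdges
  rw [hb.blue_shadowReal, flipAll_involutive ω]
  exact hb.redEdges_shadowReal_dual ω

omit hb in
/-- A realisation agrees with the base off the edges touching the arms and the decoration. -/
lemma ShadowBase.shadowReal_apply_of_not_touches {ω : Config κ} {e : E}
    (he : e ∉ touches ends ({h} ∪ {x | ∃ j, x ∈ B j} ∪ Z)) :
    shadowReal ends B Z k₀ σ ω e = σ e := by
  apply ShadowBase.shadowReal_apply_of_notMem
  rintro ⟨x, hx, y, hxy⟩
  rcases hx with ⟨j, hxj⟩ | hxZ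
  · exact he ⟨x, Or.inl (Or.inr ⟨j, hxj⟩), y, hxy⟩
  · exact he ⟨x, Or.inr hxZ, y, hxy⟩

end Edges

section Cube

variable [Fintype E] [DecidableEq E]
variable {κ : Type*} {B : κ → Set V} {Z : Set V} {k₀ : κ} {σ : Config E} {h : V}
  (hb : ShadowBase ends σ h Z B k₀)
include hb

/-- **Every shadow point lies in the outside class** of the base (`{h} ∪ arms ∪ Z ⊆ U`). -/
theorem ShadowBase.shadowReal_mem_outClass {U : Set V} {ξ : Config E}
    (hU : {h} ∪ {x | ∃ j, x ∈ B j} ∪ Z ⊆ U) (hσ : σ ∈ outClass ends U h ξ) (ω : Config κ) :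
    shadowReal ends B Z k₀ σ ω ∈ outClass ends U h ξ := by
  rw [mem_outClass] at hσ ⊢
  refine ⟨fun e he => ?_, ?_⟩
  · rw [ShadowBase.shadowReal_apply_of_not_touches (fun h' => he (touches_mono hU h'))]
    exact hσ.1 e he
  · intro x hx
    exact hU (Or.inl (hb.hull_shadowReal_subset ω hx))

/-- **The conditioning `Q` pulls back to a lower set of the shadow cube.** -/
theorem ShadowBase.shadowReal_mem_tgtU_of_le {l o : V} (hl : l ∉ {h} ∪ {x | ∃ j, x ∈ B j} ∪ Z)
    {ω ω' : Config κ} (hω : ω ≤ ω')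
    (hQ : shadowReal ends B Z k₀ σ ω' ∈ tgtU ends l h {S : Set V | o ∈ S}) :
    shadowReal ends B Z k₀ σ ω ∈ tgtU ends l h {S : Set V | o ∈ S} := by
  simp only [tgtU, Finset.mem_filter, Finset.mem_univ, true_and, Set.mem_setOf_eq, hull,
    Set.mem_union, not_or] at hQ ⊢
  obtain ⟨⟨_, _⟩, hoA, hoB⟩ := hQ
  refine ⟨⟨?_, ?_⟩, ?_, ?_⟩
  · intro hh
    exact hl (Or.inl (hb.hull_shadowReal_subset ω (Or.inl (conn_symm hh))))
  · intro hh
    exact hl (Or.inl (hb.hull_shadowReal_subset ω (Or.inr (conn_symm hh))))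
  · exact hb.cluster_l_shadowReal_anti hl hω hoA
  · exact fun h' => hoB (hb.cluster_blue_l_shadowReal_mono hl hω h')

omit [DecidableEq E] hb in
variable (ends B Z k₀ σ) in
/-- The shadow cube: the realisations of all cube points. -/
noncomputable def shadowCube [Fintype κ] : Finset (Config E) :=
  Finset.univ.image (shadowReal ends B Z k₀ σ)

omit [DecidableEq E] hb in
/-- Membership in the shadow cube. -/
lemma mem_shadowCube [Fintype κ] {ζ' : Config E} :
    ζ' ∈ shadowCube ends B Z k₀ σ ↔ ∃ ω, shadowReal ends B Z k₀ σ ω = ζ' := by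
  simp only [shadowCube, Finset.mem_image, Finset.mem_univ, true_and]

/-- **THE SHADOW CUBE INEQUALITY**: the rigid counting inequality on the shadow cube of a shadow
base (`l` outside `{h} ∪ arms ∪ Z`), for every up-set `𝓔` of edge sets. -/
theorem ShadowBase.card_shadowCube_le [Fintype κ] {l o : V}
    (hl : l ∉ {h} ∪ {x | ∃ j, x ∈ B j} ∪ Z) {𝓔 : Set (Set E)} (h𝓔 : IsUpperSet 𝓔) :
    ((shadowCube ends B Z k₀ σ).filter fun ζ' =>
        ζ' ∈ tgtU ends l h {S : Set V | o ∈ S} ∧ redEdges ends ζ' h ∈ 𝓔).card ≤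
      ((shadowCube ends B Z k₀ σ).filter fun ζ' =>
        ζ' ∈ tgtU ends l h {S : Set V | o ∈ S} ∧ blueEdges ends ζ' h ∈ 𝓔).card := by
  have key := card_le_of_cube_edges (ends := ends) (shadowReal ends B Z k₀ σ)
    hb.shadowReal_injective (shadowCube ends B Z k₀ σ) (fun ζ' => mem_shadowCube)
    (↑(tgtU ends l h {S : Set V | o ∈ S}))
    (fun ω' ω hω hQ => hb.shadowReal_mem_tgtU_of_le hl hω hQ) h
    (fun 𝓔' h𝓔' ω ω' hω hω𝓔 => h𝓔' (hb.redEdges_shadowReal_mono hω) hω𝓔)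
    (fun 𝓔' h𝓔' ω' ω hω hω𝓔 => h𝓔' (hb.blueEdges_shadowReal_anti hω) hω𝓔)
    (fun ω => hb.blueEdges_shadowReal_flipAll ω) h𝓔
  simpa only [Finset.mem_coe] using key

end Cube

end LocRows

end Summit.Ventures.PercRepro2
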